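import Literature.NumberTheory.LFunctions.ConreyIwaniec2002SigmaRamanujan
import Literature.NumberTheory.LFunctions.ConreyIwaniec2002MeanValueDefs
import Mathlib.NumberTheory.LSeries.Dirichlet
import HarnessLib

/-!
# Conrey–Iwaniec (2002) §4, (4.32)–(4.34): the Dirichlet series of the main-term coefficients
# `σ(h)` of the genus Eisenstein series, and `IsCISigma`

B. Conrey, H. Iwaniec, *Spacing of zeros of Hecke L-functions and the class number problem*,
Acta Arith. 103 (2002) 259–312, §4 (4.27)–(4.34), §6 (6.20)–(6.26) [held text
`paper:arxiv-math_0111012`, p0012–p0013, p0015]. Third toolkit file for the registered stub S3e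
`stub_sigma_genus` of the line `theta-circle-method` (cell `landau-siegel/ls-inputs`); theorem-only.

Print (4.33)–(4.34): "Adding up both expressions in (4.27) we find that the generating Dirichlet
series of `σ(h)` is equal to `Σ_h σ(h) h^{-s} = Z(s) ζ(s) ζ(s+1) L²` with
`Z(s) = {∏_{p∣v}(p⁻¹ − p^{-s}) ∏_{p∣w}(1 − p^{-s-1}) + ∏_{p∣w}(p⁻¹ − p^{-s}) ∏_{p∣v}(1 − p^{-s-1})} ζ_q(2)/ζ(2)`"
(the signs `μ(v)`, `μ(w)` of (4.31)/(4.36) are omitted in (4.34) as printed — finding F-P64-β of the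
P64 card; they are harmless since the tree's `IsCISigma` allows `|ε₁|, |ε₂| ≤ 1`).

Here, with `κ = moebiusSqSum q = Σ_{(e,q)=1} μ(e)e⁻²` (`= ζ_q(2)/ζ(2)`), `w = q/v`:
* `LSeries_mFun` — **`Σ_h mFun v w (h) h^{-s} = ζ(s) · ζ(s+1)Σ_{n∣w} μ(n) n^{-(s+1)} · Σ_{n∣v} μ(n) n^{1-s}`**
  (`mFun = ζ * jFun w * kFun v`, Mathlib `LSeries_convolution'`; `Σ_{(n,w)=1} n^{-z} = ζ(z)Σ_{n∣w}μ(n)n^{-z}`);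
* `genusZFactor_eq_sum` — for squarefree `v, w`: `F_{v,w}(s) = (v⁻¹ Σ_{n∣v} μ(n)n^{1-s})·(Σ_{n∣w} μ(n)n^{-s-1})`;
* `LSeries_sigma_eq` — for `σ(h) = ℓ²(v·rcSum q v h + w·rcSum q w h)` (= print's (4.27)):
  **`Σ_h σ(h)h^{-s} = κ ℓ² (μ(v)F_{v,w}(s) + μ(w)F_{w,v}(s)) ζ(s) ζ(s+1)`** on `Re s > 1`, (4.34);
* **`isCISigma_rcSum`** — that `σ` satisfies the tree's `IsCISigma q ℓ σ` ((6.20)–(6.24)):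
  `|σ(h)| ≤ 2ℓ²σ₋₁(h)` (from `abs_mFun_le`, `0 ≤ κ ≤ 1`) and the Dirichlet series with
  `κ ∈ [0,1]`, `ε₁ = μ(v)`, `ε₂ = μ(w)`.

«The programme SEARCHES and TYPES; no claim about Landau–Siegel zeros, Theorems 1–2 of
arXiv:2211.02515 or a repaired Margin232 until a kernel theorem says so.»
-/

noncomputable section

open scoped LSeries.notation ArithmeticFunction.Moebius ArithmeticFunction.zeta
open Complex LSeries Finset ArithmeticFunction Literature.NumberTheory.Sieve

namespace Literature.NumberTheory.LFunctions

namespace ConreyIwaniec2002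

namespace SigmaGenus

/-! ### Casting real arithmetic functions; finite Dirichlet polynomials -/

/-- The Dirichlet convolution commutes with the cast `ℝ → ℂ`. [folklore] -/
private theorem ofReal_mul_eq_convolution (F G : ArithmeticFunction ℝ) :
    (fun n : ℕ ↦ (((F * G) n : ℝ) : ℂ)) = (fun n : ℕ ↦ ((F n : ℝ) : ℂ)) ⍟ (fun n : ℕ ↦ ((G n : ℝ) : ℂ)) := by
  funext n
  rw [convolution_def, mul_apply]
  push_cast
  rfl

/-- `Σ_{d ∣ n} μ(d) = [n = 1]` (in `ℂ`). [folklore] -/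
private theorem sum_divisors_moebius_eq (n : ℕ) :
    ∑ d ∈ n.divisors, (μ d : ℂ) = if n = 1 then 1 else 0 := by
  have h := congrArg (fun f : ArithmeticFunction ℂ ↦ f n) (coe_moebius_mul_coe_zeta (R := ℂ))
  simp only [coe_mul_zeta_apply, intCoe_apply, one_apply] at h
  rw [← h]

/-- The `L`-series of a function supported on the divisors of `w ≠ 0` is the finite sum
`Σ_{n ∣ w} f(n) n^{-s}`. [folklore] -/
private theorem LSeries_eq_sum_divisors {w : ℕ} (hw : w ≠ 0) (f : ℕ → ℂ) (hf : ∀ n, ¬ n ∣ w → f n = 0)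
    (s : ℂ) : L f s = ∑ n ∈ w.divisors, f n * (n : ℂ) ^ (-s) := by
  rw [LSeries, tsum_eq_sum (s := w.divisors)]
  · refine Finset.sum_congr rfl fun n hn ↦ ?_
    have hn0 : n ≠ 0 := Nat.ne_of_gt (Nat.pos_of_mem_divisors hn)
    rw [term_of_ne_zero hn0, cpow_neg, div_eq_mul_inv]
  · intro n hn
    rcases Nat.eq_zero_or_pos n with rfl | hn0
    · exact term_zero f s
    · have hnw : ¬ n ∣ w := fun h ↦ hn (Nat.mem_divisors.mpr ⟨h, hw⟩)
      rw [term_of_ne_zero hn0.ne', hf n hnw, zero_div]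

/-- **`Σ_{(n,w)=1} n^{-z} = ζ(z)·Σ_{n∣w} μ(n) n^{-z}`** for `Re z > 1` (`[(n,w)=1] = Σ_{d∣(n,w)} μ(d)`,
i.e. `𝟙_{(·,w)=1} = 1 ⍟ μ𝟙_{·∣w}`). [cite: ConreyIwaniec2002, §4 (4.34)] -/
theorem LSeries_coprime_indicator {w : ℕ} (hw : w ≠ 0) {z : ℂ} (hz : 1 < z.re) :
    L (fun n : ℕ ↦ if n.Coprime w then (1 : ℂ) else 0) z =
      riemannZeta z * ∑ n ∈ w.divisors, (μ n : ℂ) * (n : ℂ) ^ (-z) := by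
  set g : ℕ → ℂ := fun n ↦ if n ∣ w then (μ n : ℂ) else 0 with hg
  have hconv : ∀ n : ℕ, n ≠ 0 →
      (if n.Coprime w then (1 : ℂ) else 0) = ((fun _ : ℕ ↦ (1 : ℂ)) ⍟ g) n := by
    intro n hn
    rw [convolution_def]
    simp only
    rw [Nat.sum_divisorsAntidiagonal' (f := fun _ y ↦ (1 : ℂ) * g y)]
    simp only [one_mul, hg, Finset.sum_ite, Finset.sum_const_zero, add_zero]
    have hfilter : n.divisors.filter (fun y ↦ y ∣ w) = (Nat.gcd n w).divisors := by
      rw [← Nat.divisors_filter_dvd_of_dvd hn (Nat.gcd_dvd_left n w)]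
      refine Finset.filter_congr fun y hy ↦ ?_
      have hyd : y ∣ n := Nat.dvd_of_mem_divisors hy
      exact ⟨fun h ↦ Nat.dvd_gcd hyd h, fun h ↦ h.trans (Nat.gcd_dvd_right n w)⟩
    rw [hfilter, sum_divisors_moebius_eq]
  have h1 : LSeriesSummable (fun _ : ℕ ↦ (1 : ℂ)) z :=
    LSeriesSummable_of_bounded_of_one_lt_re (m := 1) (fun n _ ↦ by simp) hz
  have h2 : LSeriesSummable g z := by
    refine LSeriesSummable_of_bounded_of_one_lt_re (m := 1) (fun n _ ↦ ?_) hz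
    simp only [hg]
    split_ifs
    · exact_mod_cast (abs_moebius_le_one (n := n))
    · simp
  rw [LSeries_congr (fun {n} hn ↦ hconv n hn), LSeries_convolution' h1 h2]
  congr 1
  · exact LSeries_one_eq_riemannZeta hz
  · exact LSeries_eq_sum_divisors hw g (fun n hn ↦ by simp [hg, hn]) z |>.trans
      (Finset.sum_congr rfl fun n hn ↦ by rw [hg]; simp [Nat.dvd_of_mem_divisors hn])

/-- **`Σ_n jFun w (n) n^{-s} = ζ(s+1) Σ_{n∣w} μ(n) n^{-(s+1)}`** (`jFun w (n) n^{-s} = [(n,w)=1] n^{-(s+1)}`).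
[cite: ConreyIwaniec2002, §4 (4.34)] -/
theorem LSeries_jFun {w : ℕ} (hw : w ≠ 0) {s : ℂ} (hs : 1 < s.re) :
    L ↗(jFun w) s = riemannZeta (s + 1) * ∑ n ∈ w.divisors, (μ n : ℂ) * (n : ℂ) ^ (-(s + 1)) := by
  have hs1 : 1 < (s + 1).re := by simp; linarith
  rw [← LSeries_coprime_indicator hw hs1, LSeries, LSeries]
  refine tsum_congr fun n ↦ ?_
  rcases Nat.eq_zero_or_pos n with rfl | hn
  · simp
  · rw [term_of_ne_zero hn.ne', term_of_ne_zero hn.ne', jFun_apply]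
    have hn0 : (n : ℂ) ≠ 0 := by exact_mod_cast hn.ne'
    split_ifs
    · push_cast
      rw [cpow_add _ _ hn0, cpow_one]
      field_simp
    · push_cast
      simp

/-- **`Σ_n kFun v (n) n^{-s} = Σ_{n∣v} μ(n) n^{1-s}`** (finite support). [cite: ConreyIwaniec2002, §4 (4.34)] -/
theorem LSeries_kFun {v : ℕ} (hv : v ≠ 0) (s : ℂ) :
    L ↗(kFun v) s = ∑ n ∈ v.divisors, (μ n : ℂ) * (n : ℂ) ^ (1 - s) := by
  rw [LSeries_eq_sum_divisors hv (↗(kFun v)) (fun n hn ↦ by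
    simp only [kFun_apply, if_neg hn]; push_cast; rfl) s]
  refine Finset.sum_congr rfl fun n hn ↦ ?_
  have hn0 : (n : ℂ) ≠ 0 := by exact_mod_cast Nat.ne_of_gt (Nat.pos_of_mem_divisors hn)
  rw [kFun_apply, if_pos (Nat.dvd_of_mem_divisors hn)]
  push_cast
  rw [sub_eq_add_neg, cpow_add _ _ hn0, cpow_one]
  ring

/-- `LSeriesSummable` of `↗(jFun w)` for `Re s > 1` (`|jFun w n| ≤ 1`). [folklore] -/
private theorem LSeriesSummable_jFun (w : ℕ) {s : ℂ} (hs : 1 < s.re) : LSeriesSummable ↗(jFun w) s := by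
  refine LSeriesSummable_of_bounded_of_one_lt_re (m := 1) (fun n hn ↦ ?_) hs
  rw [jFun_apply]
  split_ifs
  · push_cast
    rw [norm_inv, Complex.norm_natCast]
    exact inv_le_one_of_one_le₀ (by exact_mod_cast Nat.one_le_iff_ne_zero.mpr hn)
  · simp

/-- `LSeriesSummable` of `↗(kFun v)` for `Re s > 1` (`|kFun v n| ≤ v`). [folklore] -/
private theorem LSeriesSummable_kFun {v : ℕ} (hv : v ≠ 0) {s : ℂ} (hs : 1 < s.re) :
    LSeriesSummable ↗(kFun v) s := by
  refine LSeriesSummable_of_bounded_of_one_lt_re (m := v) (fun n _ ↦ ?_) hs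
  rw [kFun_apply]
  split_ifs with h
  · push_cast
    rw [norm_mul, Complex.norm_intCast, Complex.norm_natCast]
    have h1 : |((μ n : ℤ) : ℝ)| ≤ 1 := by exact_mod_cast (abs_moebius_le_one (n := n))
    have h2 : (n : ℝ) ≤ v := by exact_mod_cast Nat.le_of_dvd (Nat.pos_of_ne_zero hv) h
    calc |((μ n : ℤ) : ℝ)| * (n : ℝ) ≤ 1 * v := by gcongr
      _ = v := one_mul _
  · simp

/-- `LSeriesSummable` of `↗ζ` (the arithmetic function `ζ` over `ℝ`) for `Re s > 1`. [folklore] -/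
private theorem LSeriesSummable_zetaR {s : ℂ} (hs : 1 < s.re) :
    LSeriesSummable ↗((ζ : ArithmeticFunction ℝ)) s := by
  refine LSeriesSummable_of_bounded_of_one_lt_re (m := 1) (fun n hn ↦ ?_) hs
  rw [natCoe_apply, zeta_apply_ne hn]
  simp

/-- **`Σ_h mFun v w (h) h^{-s} = ζ(s) · (ζ(s+1) Σ_{n∣w} μ(n) n^{-(s+1)}) · Σ_{n∣v} μ(n) n^{1-s}`** for
`Re s > 1` (`mFun = ζ * jFun w * kFun v` and `LSeries_convolution'`). [cite: ConreyIwaniec2002, §4 (4.34)] -/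
theorem LSeries_mFun {v w : ℕ} (hv : v ≠ 0) (hw : w ≠ 0) {s : ℂ} (hs : 1 < s.re) :
    L ↗(mFun v w) s = riemannZeta s *
      ((riemannZeta (s + 1) * ∑ n ∈ w.divisors, (μ n : ℂ) * (n : ℂ) ^ (-(s + 1))) *
        ∑ n ∈ v.divisors, (μ n : ℂ) * (n : ℂ) ^ (1 - s)) := by
  have hjk : (fun n : ℕ ↦ (((jFun w * kFun v) n : ℝ) : ℂ)) = ↗(jFun w) ⍟ ↗(kFun v) :=
    ofReal_mul_eq_convolution _ _
  have hm : (fun n : ℕ ↦ ((mFun v w n : ℝ) : ℂ)) =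
      ↗((ζ : ArithmeticFunction ℝ)) ⍟ (↗(jFun w) ⍟ ↗(kFun v)) := by
    rw [← hjk, mFun]; exact ofReal_mul_eq_convolution _ _
  have hsumjk : LSeriesSummable (↗(jFun w) ⍟ ↗(kFun v)) s :=
    (LSeriesSummable_jFun w hs).convolution (LSeriesSummable_kFun hv hs)
  rw [hm, LSeries_convolution' (LSeriesSummable_zetaR hs) hsumjk,
    LSeries_convolution' (LSeriesSummable_jFun w hs) (LSeriesSummable_kFun hv hs),
    LSeries_jFun hw hs, LSeries_kFun hv]
  congr 1
  rw [← LSeries_one_eq_riemannZeta hs]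
  refine LSeries_congr (fun {n} hn ↦ ?_) s
  rw [natCoe_apply, zeta_apply_ne hn]
  simp

/-! ### The Euler factors `F_{v,w}` of (4.34) as Dirichlet polynomials -/

/-- For squarefree `n`: `∏_{p∣n}(1 − p^z) = Σ_{d∣n} μ(d) d^z` (`d ↦ d^z` is completely multiplicative).
[cite: ConreyIwaniec2002, §4 (4.34)] -/
theorem prod_one_sub_cpow_eq {n : ℕ} (hn : Squarefree n) (z : ℂ) :
    ∏ p ∈ n.primeFactors, (1 - (p : ℂ) ^ z) = ∑ d ∈ n.divisors, (μ d : ℂ) * (d : ℂ) ^ z := by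
  set P : ArithmeticFunction ℂ := ⟨fun d ↦ if d = 0 then 0 else (d : ℂ) ^ z, if_pos rfl⟩ with hP
  have hPapply : ∀ d : ℕ, d ≠ 0 → P d = (d : ℂ) ^ z := fun d hd ↦ by
    simp only [hP, ArithmeticFunction.coe_mk, if_neg hd]
  have hmult : P.IsMultiplicative := by
    refine ⟨by rw [hPapply 1 one_ne_zero]; simp, fun {a b} hab ↦ ?_⟩
    rcases Nat.eq_zero_or_pos a with rfl | ha
    · simp [hP]
    rcases Nat.eq_zero_or_pos b with rfl | hb
    · simp [hP]
    rw [hPapply _ (Nat.mul_ne_zero ha.ne' hb.ne'), hPapply _ ha.ne', hPapply _ hb.ne',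
      Nat.cast_mul, natCast_mul_natCast_cpow]
  have hprod : ∏ p ∈ n.primeFactors, (1 - (p : ℂ) ^ z) = ∏ p ∈ n.primeFactors, (1 - P p) :=
    Finset.prod_congr rfl fun p hp ↦ by
      rw [hPapply p (Nat.prime_of_mem_primeFactors hp).ne_zero]
  rw [hprod, hmult.prodPrimeFactors_one_sub_of_squarefree _ hn]
  refine Finset.sum_congr rfl fun d hd ↦ ?_
  rw [hPapply d (Nat.ne_of_gt (Nat.pos_of_mem_divisors hd))]

/-- **`F_{v,w}(s) = (v⁻¹ Σ_{n∣v} μ(n) n^{1-s})·(Σ_{n∣w} μ(n) n^{-s-1})`** for squarefree `v`, `w`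
(`∏_{p∣v}(p⁻¹ − p^{-s}) = v⁻¹∏_{p∣v}(1 − p^{1-s})`). [cite: ConreyIwaniec2002, §4 (4.34)] -/
theorem genusZFactor_eq_sum {v w : ℕ} (hv : Squarefree v) (hw : Squarefree w) (s : ℂ) :
    genusZFactor v w s =
      ((v : ℂ)⁻¹ * ∑ n ∈ v.divisors, (μ n : ℂ) * (n : ℂ) ^ (1 - s)) *
        ∑ n ∈ w.divisors, (μ n : ℂ) * (n : ℂ) ^ (-s - 1) := by
  rw [genusZFactor, ← prod_one_sub_cpow_eq hw, ← prod_one_sub_cpow_eq hv]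
  congr 1
  have hterm : ∀ p ∈ v.primeFactors,
      ((p : ℂ)⁻¹ - (p : ℂ) ^ (-s)) = (p : ℂ)⁻¹ * (1 - (p : ℂ) ^ (1 - s)) := by
    intro p hp
    have hp0 : (p : ℂ) ≠ 0 := by exact_mod_cast (Nat.prime_of_mem_primeFactors hp).ne_zero
    rw [sub_eq_add_neg (1 : ℂ) s, cpow_add _ _ hp0, cpow_one]
    field_simp
  rw [Finset.prod_congr rfl hterm, Finset.prod_mul_distrib, Finset.prod_inv_distrib,
    ← Nat.cast_prod, Nat.prod_primeFactors_of_squarefree hv]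

/-! ### The Dirichlet series of `σ(h)` and `IsCISigma` -/

/-- **(4.34) with its signs**: for squarefree `q`, `v ∣ q`, `w = q/v`, real weights `a, b`, and
any `σ` with `σ(h) = ℓ²(a·v·Σ_{(c,q)=v} r_c(h)c⁻² + b·w·Σ_{(c,q)=w} r_c(h)c⁻²)` for `h ≥ 1`
((4.27) is `a = b = 1`): `Σ_h σ(h) h^{-s} = κ ℓ² (aμ(v)F_{v,w}(s) + bμ(w)F_{w,v}(s)) ζ(s)ζ(s+1)` on
`Re s > 1`, `κ = Σ_{(e,q)=1} μ(e)e⁻² = ζ_q(2)/ζ(2)`. [cite: ConreyIwaniec2002, §4 (4.33)–(4.34)] -/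
theorem LSeries_sigma_eq {q v : ℕ} (hq : Squarefree q) (hv : v ∣ q) (ℓ a b : ℝ) {σ : ℕ → ℝ}
    (hσ : ∀ h : ℕ, h ≠ 0 → σ h =
      ℓ ^ 2 * (a * ((v : ℝ) * rcSum q v h) + b * (((q / v : ℕ) : ℝ) * rcSum q (q / v) h)))
    {s : ℂ} (hs : 1 < s.re) :
    L (fun h : ℕ ↦ ((σ h : ℝ) : ℂ)) s =
      (moebiusSqSum q : ℂ) * (ℓ : ℂ) ^ 2 *
        (((a * (μ v : ℝ) : ℝ) : ℂ) * genusZFactor v (q / v) s +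
          ((b * (μ (q / v) : ℝ) : ℝ) : ℂ) * genusZFactor (q / v) v s) *
        riemannZeta s * riemannZeta (s + 1) := by
  set w := q / v with hw
  have hq0 : q ≠ 0 := hq.ne_zero
  have hvw : v * w = q := Nat.mul_div_cancel' hv
  have hwq : w ∣ q := Dvd.intro_left v hvw
  have hqw : q / w = v := by
    rw [hw]; exact Nat.div_div_self hv hq0
  have hvsq : Squarefree v := hq.squarefree_of_dvd hv
  have hwsq : Squarefree w := hq.squarefree_of_dvd hwq
  have hv0 : v ≠ 0 := hvsq.ne_zero
  have hw0 : w ≠ 0 := hwsq.ne_zero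
  have hv0' : (v : ℂ) ≠ 0 := by exact_mod_cast hv0
  have hw0' : (w : ℂ) ≠ 0 := by exact_mod_cast hw0
  set κ := moebiusSqSum q with hκ
  -- pointwise: `σ(h) = κℓ²(aμ(v) mFun v w h / v + bμ(w) mFun w v h / w)` for `h ≠ 0`
  have hpt : ∀ {h : ℕ}, h ≠ 0 →
      ((σ h : ℝ) : ℂ) =
        ((κ : ℂ) * ℓ ^ 2 * (a * (μ v : ℂ)) / (v : ℂ)) * ((mFun v w h : ℝ) : ℂ) +
          ((κ : ℂ) * ℓ ^ 2 * (b * (μ w : ℂ)) / (w : ℂ)) * ((mFun w v h : ℝ) : ℂ) := by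
    intro h hh
    rw [hσ h hh, rcSum_eq hq hv hh, rcSum_eq hq hwq hh, hqw]
    push_cast
    field_simp
    ring
  have hsum1 : LSeriesSummable ↗(mFun v w) s := by
    have := (LSeriesSummable_zetaR hs).convolution
      ((LSeriesSummable_jFun w hs).convolution (LSeriesSummable_kFun hv0 hs))
    rw [← ofReal_mul_eq_convolution, ← ofReal_mul_eq_convolution] at this
    exact this
  have hsum2 : LSeriesSummable ↗(mFun w v) s := by
    have := (LSeriesSummable_zetaR hs).convolution
      ((LSeriesSummable_jFun v hs).convolution (LSeriesSummable_kFun hw0 hs))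
    rw [← ofReal_mul_eq_convolution, ← ofReal_mul_eq_convolution] at this
    exact this
  rw [LSeries_congr (fun {h} hh ↦ hpt hh)]
  rw [show (fun h : ℕ ↦ ((κ : ℂ) * ℓ ^ 2 * (a * (μ v : ℂ)) / (v : ℂ)) * ((mFun v w h : ℝ) : ℂ) +
          ((κ : ℂ) * ℓ ^ 2 * (b * (μ w : ℂ)) / (w : ℂ)) * ((mFun w v h : ℝ) : ℂ)) =
        (((κ : ℂ) * ℓ ^ 2 * (a * (μ v : ℂ)) / (v : ℂ)) • ↗(mFun v w)) +
          (((κ : ℂ) * ℓ ^ 2 * (b * (μ w : ℂ)) / (w : ℂ)) • ↗(mFun w v)) from rfl,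
    LSeries_add (hsum1.smul _) (hsum2.smul _), LSeries_smul, LSeries_smul,
    LSeries_mFun hv0 hw0 hs, LSeries_mFun hw0 hv0 hs,
    genusZFactor_eq_sum hvsq hwsq, genusZFactor_eq_sum hwsq hvsq,
    show -s - 1 = -(s + 1) by ring]
  push_cast
  field_simp

/-- **`σ` satisfies `IsCISigma q ℓ σ`** whenever `σ(h) = ℓ²(a·v·Σ_{(c,q)=v} r_c(h)c⁻² + b·w·Σ_{(c,q)=w} r_c(h)c⁻²)`
for `h ≥ 1` with `|a|, |b| ≤ 1`, `q` squarefree and odd, `v ∣ q`, `w = q/v` ((6.20)–(6.24) for the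
genus Eisenstein series, `a = b = 1`): `|σ(h)| ≤ 2ℓ²σ₋₁(h)` (by (4.32): `|v·Σ_{(c,q)=v}| ≤ κ((h,v)/v)σ₋₁(h)
≤ κσ₋₁(h)`, `κ ≤ 1`) and the Dirichlet series (4.34) with `κ = ζ_q(2)/ζ(2) ∈ [0,1]`, `ε₁ = aμ(v)`,
`ε₂ = bμ(w)`. [cite: ConreyIwaniec2002, §4 (4.32)–(4.34); §6 (6.20)–(6.26)] -/
theorem isCISigma_of_eq_rcSum {q v : ℕ} (hq : Squarefree q) (hodd : Odd q) (hv : v ∣ q)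
    (ℓ a b : ℝ) (ha : |a| ≤ 1) (hb : |b| ≤ 1) {σ : ℕ → ℝ}
    (hσ : ∀ h : ℕ, h ≠ 0 → σ h =
      ℓ ^ 2 * (a * ((v : ℝ) * rcSum q v h) + b * (((q / v : ℕ) : ℝ) * rcSum q (q / v) h))) :
    IsCISigma q ℓ σ := by
  set w := q / v with hw
  have hq0 : q ≠ 0 := hq.ne_zero
  have hvw : v * w = q := Nat.mul_div_cancel' hv
  have hwq : w ∣ q := Dvd.intro_left v hvw
  have hqw : q / w = v := by rw [hw]; exact Nat.div_div_self hv hq0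
  have hvsq : Squarefree v := hq.squarefree_of_dvd hv
  have hwsq : Squarefree w := hq.squarefree_of_dvd hwq
  have hv0 : v ≠ 0 := hvsq.ne_zero
  have hw0 : w ≠ 0 := hwsq.ne_zero
  have hvpos : (0 : ℝ) < v := by exact_mod_cast Nat.pos_of_ne_zero hv0
  have hwpos : (0 : ℝ) < w := by exact_mod_cast Nat.pos_of_ne_zero hw0
  have hκ0 : 0 ≤ moebiusSqSum q := moebiusSqSum_nonneg hodd
  have hκ1 : moebiusSqSum q ≤ 1 := moebiusSqSum_le_one hodd
  have hμ : ∀ n : ℕ, |(μ n : ℝ)| ≤ 1 := fun n ↦ by exact_mod_cast (abs_moebius_le_one (n := n))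
  have hε : ∀ (t : ℝ) (n : ℕ), |t| ≤ 1 → |t * (μ n : ℝ)| ≤ 1 := fun t n ht ↦ by
    rw [abs_mul]
    calc |t| * |(μ n : ℝ)| ≤ 1 * 1 := mul_le_mul ht (hμ n) (abs_nonneg _) zero_le_one
      _ = 1 := one_mul 1
  refine ⟨fun h hh ↦ ?_, Or.inr ⟨v, w, moebiusSqSum q, a * (μ v : ℝ), b * (μ w : ℝ), hvw, hκ0, hκ1,
    hε a v ha, hε b w hb, fun s hs ↦ ?_⟩⟩
  · -- the bound `|σ(h)| ≤ 2ℓ²σ₋₁(h)`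
    have hh0 : h ≠ 0 := by omega
    set S := ∑ d ∈ Nat.divisors h, (d : ℝ)⁻¹ with hS
    have hS0 : 0 ≤ S := Finset.sum_nonneg fun d _ ↦ by positivity
    have hM1 : |mFun v w h| ≤ v * S := by
      refine (abs_mFun_le hvsq w h).trans (mul_le_mul_of_nonneg_right ?_ hS0)
      exact_mod_cast Nat.gcd_le_right (m := h) (n := v) (Nat.pos_of_ne_zero hv0)
    have hM2 : |mFun w v h| ≤ w * S := by
      refine (abs_mFun_le hwsq v h).trans (mul_le_mul_of_nonneg_right ?_ hS0)
      exact_mod_cast Nat.gcd_le_right (m := h) (n := w) (Nat.pos_of_ne_zero hw0)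
    have hA : |a * (μ v : ℝ) * mFun v w h / v| ≤ S := by
      rw [abs_div, abs_mul, Nat.abs_cast, div_le_iff₀ hvpos]
      calc |a * (μ v : ℝ)| * |mFun v w h| ≤ 1 * (v * S) :=
            mul_le_mul (hε a v ha) hM1 (abs_nonneg _) zero_le_one
        _ = S * v := by ring
    have hB : |b * (μ w : ℝ) * mFun w v h / w| ≤ S := by
      rw [abs_div, abs_mul, Nat.abs_cast, div_le_iff₀ hwpos]
      calc |b * (μ w : ℝ)| * |mFun w v h| ≤ 1 * (w * S) :=
            mul_le_mul (hε b w hb) hM2 (abs_nonneg _) zero_le_one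
        _ = S * w := by ring
    rw [hσ h hh0, rcSum_eq hq hv hh0, rcSum_eq hq hwq hh0, hqw]
    have heq : ℓ ^ 2 * (a * ((v : ℝ) * (moebiusSqSum q * (μ v : ℝ) * mFun v w h / (v : ℝ) ^ 2)) +
        b * ((w : ℝ) * (moebiusSqSum q * (μ w : ℝ) * mFun w v h / (w : ℝ) ^ 2))) =
        ℓ ^ 2 * moebiusSqSum q *
          (a * (μ v : ℝ) * mFun v w h / v + b * (μ w : ℝ) * mFun w v h / w) := by
      field_simp
    rw [heq, abs_mul, abs_mul, abs_of_nonneg (sq_nonneg ℓ), abs_of_nonneg hκ0]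
    calc ℓ ^ 2 * moebiusSqSum q * |a * (μ v : ℝ) * mFun v w h / v + b * (μ w : ℝ) * mFun w v h / w|
        ≤ ℓ ^ 2 * 1 * (S + S) := by
          gcongr
          exact (abs_add_le _ _).trans (add_le_add hA hB)
      _ = 2 * ℓ ^ 2 * S := by ring
  · -- the Dirichlet series (4.34)
    have h := LSeries_sigma_eq hq hv ℓ a b hσ hs
    push_cast at h ⊢
    rw [h]

end SigmaGenus

end ConreyIwaniec2002

end Literature.NumberTheory.LFunctions

end
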